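/- Copyright: the b2b-balaban cell (near-miss cell 7), T⁴-continuum fan-out, ROUND-2 swarm `t4-ne7b-formalise-*`
(leaf 08, gen 2), row NE7b (node U5c COUNT member).  Released under the licence of the surrounding project. -/
import Summits.QuantumFields.BalabanUV.T4Continuum.Support.HistoryAssemblyRealiseLE
import Summits.QuantumFields.BalabanUV.T4Continuum.Support.HistoryLevels

/-!
# Realised histories: the ROOT CELLS of realised pending pedigrees, from the geometry (node A12-I.2 (iii))

Summits-side support leaf of the T⁴-continuum cell (rung (B)+1 on a FINITE torus only; NOT infinite volume, NOT the
mass gap, NOT the Clay statement; NOT a proof of the spine estimate NE7b).  Row S1b «H1b geometric layer» of the swarm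
claim table `t4/b2b-balaban-t4-ne7b-p1/LEAVES-NE7b.md` (v2.9), part 5; typer node A12-I.2 (iii) ∕ cut A12-I.2b-cells
(`t4/formal/NE7b/DAG.md` v2.6, typer notes T-NE7b-5 (iii′), T-NE7b-6′; journal CLAIM «NE7b-A12-I.2b-cells»).

WHY.  The current END of the COUNT route, `HistoryAssemblyRealiseLE.hybridNE7_of_realisedReading_canon` (leaf-03,
p210803), reads the live structures of the bad terms as REALISED PENDING PEDIGREES (`RealisedReading`) and displays, next
to the geometric field `real`, TWO ROOT-CELL FIELDS of the reading map `cellOf`: `cell_mem` (the root cell of a live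
component is a cell of the root's age in the table `HistoryTables.cellN`) and `cell_inj` (distinct live components of
one term have distinct root cells).  This file DISCHARGES both from the geometry of row S1b (`HistoryRealise.Realises`,
`rootAnchor`, `orbit`, p209120), following the typer's recipe T-NE7b-6′ to the letter: Skolemise the realising domains
`Z : ℕ → ι → α → Finset (Pt d)` and display, per bad term and live component, the print-faithful data
* `track` — the re-blocked anchor cube of the first-born constituent lies in the component's domain («j(Z) is the index
  of a first large field region contained in Z», B16 p. 384 ll. 7–8 — CONTEXT, under audit, not asserted);
* `disjoint` — distinct live components of one term have DISJOINT current domains at the cutoff («components» of the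
  step-K large-field region, B16 p. 383 ∕ p. 386 — CONTEXT);
* `inBox` — root anchors lie in ONE period box of the `n·L^K` torus, at the MODEL SCALE of their birth step
  (`HistoryZones.levelOf sP K j = j + s_j − s_K`, row S6f ∕ leaf-07 p209950: the step-`j` cubes are `M R_j`-cubes,
  `R_j = L^{s_j}`);
and DEFINE `cellOf` := the CORNER CELL `L^{levelOf}·anchor` read through `Fin.val` (`cornerCell`, corner-consistent across
ages — the shape of leaf-01's `HistoryZones.birthCell`, p207713).  Then `cell_mem` is `HistoryTables.valVec_mem_cellN`
with `HistoryZones.isScale_of_le`∕`le_levelOf`, and `cell_inj` holds on ABSOLUTE corners: equal corners of two anchor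
cubes force the cubes to be NESTED (`coarse`, `B16SProfile.Qprod_ratio_mul_pow`), the S-operation is EXPANSIVE modulo
re-blocking (`coarse_Qprod_mem_Siter`: `x ∈ Z → coarse (Qprod q i) x ∈ Siter q i Z`), so by `track` both current
domains at the cutoff contain the re-blocked older anchor — contradicting `disjoint`.  (At equal root steps this is
row S1b's `rootAnchor_ne_of_disjoint`.)

WHAT.  §1 re-blocking arithmetic in the ℤᵈ index model: `Qfrom L s j i` (the accumulated ratio from step `j`),
`Qfrom_add`, `coarse_mem_Sop`, `coarse_Qprod_mem_Siter`, `coarse_Qfrom_mem_orbit`; §2 levels: `Qfrom_mul_pow`,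
**`Qfrom_eq_pow_levelOf_sub`** (from `j` to `j′` one re-blocks by `L^{levelOf j′ − levelOf j}`, for stepwise
non-increasing drop-controlled exponents); §3 corner cells: `cornerCell`, **`cornerCell_mem_cellN`**,
**`coarse_eq_of_cornerCell_eq`**; §4 anchors along the flow: `anchorAt`, `curDomain`,
**`anchorAt_mem_curDomain`**; §5 **`structure RealisedDomains`** (the displayed reading, Skolemised) and
**`realisedReading_of_domains : RealisedDomains … → RealisedReading L s (cellN d n L) K₀ R T ped cellP liveC
(cellOfA n L s ped cellP)`** — leaf-03's END binder `H` BY NAME, with NO cell field left.  The companion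
`Support/HistoryRealiseCellsEnd.lean` carries the END twin `hybridNE7_of_realisedDomains_canon` and the service lemmas
`tracks_birth` ∕ `tracks_renew` ∕ `tracks_join_left∕right` (the display `track` is automatic at births and renewals and
reduces, at a join, to «the joined domain contains the older partner's current image» — the lower half of B16 p. 386's
merger sentence, which `Realises` (upper half, (1.84)) does not record).  [folklore] finite combinatorics + composition
by name; ONE new `structure … : Prop` (hypothesis shape, trigger condition c1: no `Prop` FACT of print minted); no
`[cite:]` tag.

HONEST.  Index-model geometry and torus bookkeeping on OUR carriers; the identification of Bałaban's terms with realised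
pending pedigrees (H3: the reading map, `real`, `track`, `disjoint`, `inBox`), (B) and the BetaPertH-flow facts stay
DISPLAYED; the flow side condition «`sP` stepwise non-increasing» is displayed (leaf-07's `HistoryZones.windowExp_succ_le`
derives it from (2.5) + monotone couplings).  NE7b NOT proved; spine 0∕9.  HONEST DEPENDENCY (cell): continuum YM on T⁴ ⇐
BetaPertH ∧ nine spine estimates (0/9 proved); BetaPertH ⇐ (D1) ∧ (D4) ∧ CAP+tail; G-an2-4 gates asym, D1 and NE2/3/4.
This file changes none of it. -/

open Finset MeasureTheory
open Literature.MathematicalPhysics.QuantumFieldTheory.Balaban1983to89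
open Literature.MathematicalPhysics.QuantumFieldTheory.Balaban1983to89.B13ScaleTransfer
open Literature.MathematicalPhysics.QuantumFieldTheory.Balaban1983to89.B16SProfile
open Literature.MathematicalPhysics.QuantumFieldTheory.Balaban1983to89.B16MergeHorizon
open T4PersistenceDictionary T4PersistentHistoryCount T4BankedInduction T4PrintedShapeBanking
open T4WeightBudget T4GlobalDenominator T4LiveClassFibration T4LiveStructureGas T4LiveGasToTerms T4RecordPriceSeam
open T4PartnerMultiplicity T4IndicatorShell T4MatchingAssembly T4MatchingClosure T4MatchingClosureSocket T4Continuum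
open T4StabilitySocket T4BranchingRecordsGas T4TaggedShapeBanking T4CanonicalMenus T4RenewalChains
open Summit.QuantumFields.BalabanUV.T4Continuum.PlacementBatch
open Summit.QuantumFields.BalabanUV.T4Continuum.PlacementSkeleton
open Summit.QuantumFields.BalabanUV.T4Continuum.CountThresholdUniform
open Summit.QuantumFields.BalabanUV.T4Continuum.CountThresholdExit
open Summit.QuantumFields.BalabanUV.T4Continuum.CountSeamJunction
open Summit.QuantumFields.BalabanUV.T4Continuum.LateMergers
open Summit.QuantumFields.BalabanUV.T4Continuum.HistoryFlow
open Summit.QuantumFields.BalabanUV.T4Continuum.HistoryRegeneration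
open Summit.QuantumFields.BalabanUV.T4Continuum.HistoryTables
open Summit.QuantumFields.BalabanUV.T4Continuum.HistoryAssemblyTrees
open Summit.QuantumFields.BalabanUV.T4Continuum.HistorySocketTH
open Summit.QuantumFields.BalabanUV.T4Continuum.HistoryAssemblyTerms
open Summit.QuantumFields.BalabanUV.T4Continuum.HistoryGen
open Summit.QuantumFields.BalabanUV.T4Continuum.HistoryCaps
open Summit.QuantumFields.BalabanUV.T4Continuum.ZoneTorus
open Summit.QuantumFields.BalabanUV.T4Continuum.HistoryZones
open Summit.QuantumFields.BalabanUV.T4Continuum.HistoryAdmissible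
open Summit.QuantumFields.BalabanUV.T4Continuum.HistoryAssemblyPedigree
open Summit.QuantumFields.BalabanUV.T4Continuum.HistoryBankingLE
open Summit.QuantumFields.BalabanUV.T4Continuum.HistoryTreeShapeLE
open Summit.QuantumFields.BalabanUV.T4Continuum.HistoryExitLE
open Summit.QuantumFields.BalabanUV.T4Continuum.HistoryAssemblyTreesLE
open Summit.QuantumFields.BalabanUV.T4Continuum.HistoryAssemblyTermsLE
open Summit.QuantumFields.BalabanUV.T4Continuum.HistoryAssemblyRealiseLE
open Summit.QuantumFields.BalabanUV.T4Continuum.HistoryRealise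

namespace Summit.QuantumFields.BalabanUV.T4Continuum.HistoryRealiseCells

noncomputable section

variable {d : ℕ}

/-! ## §1 Re-blocking arithmetic in the index model: the S-operation is expansive modulo `coarse` -/

/-- **THE ACCUMULATED RATIO FROM STEP `j`**: `Qfrom L s j i` = the side of the step-`(j+i)` cubes in units of step-`j`
cubes along the flow with exponents `s` (`B16SProfile.Qprod` of the ratio sequence read from `j`, as in
`HistoryRealise.orbit`). [folklore] -/
def Qfrom (L : ℕ) (s : ℕ → ℕ) (j i : ℕ) : ℕ := Qprod (ratio L fun l => s (j + l)) i

/-- no step, no re-blocking [folklore] -/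
@[simp] theorem Qfrom_zero (L : ℕ) (s : ℕ → ℕ) (j : ℕ) : Qfrom L s j 0 = 1 := Qprod_zero _

/-- accumulated ratios compose along the flow: from `j` over `a + b` steps = from `j` over `a`, then from `j + a` over
`b` [folklore] -/
theorem Qfrom_add (L : ℕ) (s : ℕ → ℕ) (j a b : ℕ) : Qfrom L s j (a + b) = Qfrom L s j a * Qfrom L s (j + a) b := by
  unfold Qfrom Qprod
  rw [Finset.prod_range_add]
  congr 1
  refine Finset.prod_congr rfl fun l _ => ?_
  show ratio L (fun n => s (j + n)) (a + l) = ratio L (fun n => s (j + a + n)) l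
  rw [← ratio_shift L (fun n => s (j + n)) a l]
  simp only [Nat.add_assoc]

/-- accumulated ratios are positive (`L ≥ 1`) [folklore] -/
theorem Qfrom_pos {L : ℕ} (hL : 0 < L) (s : ℕ → ℕ) (j i : ℕ) : 0 < Qfrom L s j i :=
  Qprod_pos (fun l => ratio_pos hL _ l) i

/-- **ONE S-OPERATION IS EXPANSIVE MODULO RE-BLOCKING**: the block of a cube of `X` is a cube of `S_q(X)`
(`Sop q X = collar^[10] (closureIdx q X) ⊇ closureIdx q X ∋ coarse q x`). [folklore] -/
theorem coarse_mem_Sop (q : ℕ) {X : Finset (Pt d)} {x : Pt d} (hx : x ∈ X) : coarse q x ∈ Sop q X :=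
  subset_iterate_collar 10 _ (mem_image_of_mem _ hx)

/-- **THE ITERATED S-OPERATION IS EXPANSIVE MODULO RE-BLOCKING**: the `Q_i`-block of a cube of `Z` is a cube of
`S^{i}(Z)`. [folklore] -/
theorem coarse_Qprod_mem_Siter (q : ℕ → ℕ) {Z : Finset (Pt d)} {x : Pt d} (hx : x ∈ Z) :
    ∀ i, coarse (Qprod q i) x ∈ Siter q i Z
  | 0 => by simpa [coarse_one] using hx
  | i + 1 => by
      rw [Siter_succ, Qprod_succ, ← coarse_coarse]
      exact coarse_mem_Sop (q i) (coarse_Qprod_mem_Siter q hx i)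

/-- the same along a history's orbit: the re-blocked image of a cube of the domain formed at `t₀` lies in the orbit
[folklore] -/
theorem coarse_Qfrom_mem_orbit (L : ℕ) (s : ℕ → ℕ) (t₀ : ℕ) {Z : Finset (Pt d)} {x : Pt d} (hx : x ∈ Z) (i : ℕ) :
    coarse (Qfrom L s t₀ i) x ∈ orbit L s t₀ Z i :=
  coarse_Qprod_mem_Siter _ hx i

/-! ## §2 Levels: from step `j` to step `j′` one re-blocks by `L^{levelOf j′ − levelOf j}` -/

section Levels

variable {L : ℕ} {s : ℕ → ℕ}

/-- scaling bookkeeping from step `j` (`B16SProfile.Qprod_ratio_mul_pow` on the flow read from `j`):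
`Qfrom L s j i · L^{s j} = L^{i + s (j + i)}` under drop control. [folklore] -/
theorem Qfrom_mul_pow (L : ℕ) (hdrop : ∀ m, DropCtl s m) (j i : ℕ) :
    Qfrom L s j i * L ^ s j = L ^ (i + s (j + i)) := by
  have h := Qprod_ratio_mul_pow L (dropCtl_from hdrop j i) i le_rfl
  simpa [Qfrom] using h

/-- under drop control the exponent falls by at most one per step: `s j ≤ s j′ + (j′ − j)` for `j ≤ j′` [folklore] -/
theorem windowExp_le_add_sub (hdrop : ∀ m, DropCtl s m) {j j' : ℕ} (hjj : j ≤ j') : s j ≤ s j' + (j' - j) :=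
  windowExp_le_add (hdrop j') (j' - j) j (by omega)

/-- **THE RE-BLOCKING FACTOR BETWEEN TWO STEPS IS THE LEVEL GAP**: for stepwise non-increasing, drop-controlled
exponents and `j ≤ j′ ≤ K`, `Qfrom L s j (j′ − j) = L^{levelOf s K j′ − levelOf s K j}` (`L ≥ 1`). [folklore] -/
theorem Qfrom_eq_pow_levelOf_sub (hL : 0 < L) (hs : ∀ t, s (t + 1) ≤ s t) (hdrop : ∀ m, DropCtl s m) {j j' K : ℕ}
    (hjj : j ≤ j') (hjK : j' ≤ K) : Qfrom L s j (j' - j) = L ^ (levelOf s K j' - levelOf s K j) := by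
  have hsK : ∀ t, t < K → s (t + 1) ≤ s t := fun t _ => hs t
  have h1 : s K ≤ s j' := windowExp_le_of_le hsK hjK le_rfl
  have h2 : s j' ≤ s j := windowExp_le_of_le hsK hjj hjK
  have h3 : s j ≤ s j' + (j' - j) := windowExp_le_add_sub hdrop hjj
  have hlv : levelOf s K j' - levelOf s K j = (j' - j) + s j' - s j := by
    rw [levelOf_of_le hjK, levelOf_of_le (hjj.trans hjK)]
    omega
  have hmul := Qfrom_mul_pow L hdrop j (j' - j)
  rw [show j + (j' - j) = j' by omega] at hmul
  have hsplit : L ^ ((j' - j) + s j') = L ^ ((j' - j) + s j' - s j) * L ^ s j := by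
    rw [← pow_add]; congr 1; omega
  rw [hsplit] at hmul
  rw [hlv]
  exact Nat.eq_of_mul_eq_mul_right (pow_pos hL _) hmul

end Levels

/-! ## §3 Corner cells: the torus cell of an anchor cube, corner-consistent across ages -/

/-- **THE CORNER CELL** of the index cube `a` at blocking level `lv` on the torus with `n·L^K` sites a side: the fine
cell with coordinates `L^{lv}·a_i` (reduced mod the side — a no-op in the period box), as an ℕ-vector (the currency of
`HistoryTables.cellN`; = `HistorySlots.valVec` of leaf-01's `HistoryZones.birthCell` shape). [folklore] -/
def cornerCell (n L K lv : ℕ) (a : Pt d) : Fin d → ℕ := fun i => (L ^ lv * (a i).toNat) % (n * L ^ K)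

/-- IN THE PERIOD BOX (`∀ i, 0 ≤ a i ∧ L^{lv}·a_i < n·L^K`: non-negative index, corner below the side of the
`n·L^K` torus) the corner cell's coordinates are `L^{lv}·a_i` [folklore] -/
theorem cornerCell_apply_of_inBox {n L K lv : ℕ} {a : Pt d} (h : ∀ i, 0 ≤ a i ∧ L ^ lv * (a i).toNat < n * L ^ K)
    (i : Fin d) : cornerCell n L K lv a i = L ^ lv * (a i).toNat :=
  Nat.mod_eq_of_lt (h i).2

/-- **FIELD `cell_mem`**: the corner cell at a level `lv` with `j ≤ lv ≤ K` is a cell of age `K − j` of the table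
`cellN d n L K` (a scale-`lv` cell is a scale-`j` cell, `HistoryZones.isScale_of_le`; `HistoryTables.valVec_mem_cellN`).
[folklore] -/
theorem cornerCell_mem_cellN {n L K lv j : ℕ} (hN : 0 < n * L ^ K) (hj : j ≤ lv) (hlv : lv ≤ K) (a : Pt d) :
    cornerCell n L K lv a ∈ cellN d n L K (K - j) := by
  let x : TCell d (n * L ^ K) := fun i => ⟨cornerCell n L K lv a i, Nat.mod_lt _ hN⟩
  have hx : IsScale L lv x := by
    intro i
    show L ^ lv ∣ (L ^ lv * (a i).toNat) % (n * L ^ K)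
    exact (Nat.dvd_mod_iff (dvd_mul_of_dvd_right (Nat.pow_dvd_pow L hlv) n)).2 (dvd_mul_right _ _)
  have hxj : IsScale L (K - (K - j)) x := by
    rw [Nat.sub_sub_self (hj.trans hlv)]
    exact isScale_of_le hj hx
  exact valVec_mem_cellN hxj

/-- **CORNER-CONSISTENCY**: two anchor cubes in the period box, at levels `lv ≤ lv′`, with the SAME corner cell are
NESTED — the finer one is the lowest-corner sub-cube of the coarser: `coarse (L^{lv′ − lv}) a = a′` (`L ≥ 1`).
[folklore] -/
theorem coarse_eq_of_cornerCell_eq {n L K lv lv' : ℕ} (hL : 0 < L) {a a' : Pt d}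
    (ha : ∀ i, 0 ≤ a i ∧ L ^ lv * (a i).toNat < n * L ^ K) (ha' : ∀ i, 0 ≤ a' i ∧ L ^ lv' * (a' i).toNat < n * L ^ K)
    (hle : lv ≤ lv') (heq : cornerCell n L K lv a = cornerCell n L K lv' a') :
    coarse (L ^ (lv' - lv)) a = a' := by
  have hL' : (0 : ℤ) < ((L ^ (lv' - lv) : ℕ) : ℤ) := by exact_mod_cast pow_pos hL _
  funext i
  have hi := congrFun heq i
  rw [cornerCell_apply_of_inBox ha i, cornerCell_apply_of_inBox ha' i] at hi
  -- `L^{lv}·a_i = L^{lv′}·a′_i`, so `a_i = L^{lv′−lv}·a′_i`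
  have hnat : (a i).toNat = L ^ (lv' - lv) * (a' i).toNat := by
    have h1 : L ^ lv' = L ^ lv * L ^ (lv' - lv) := by rw [← pow_add, Nat.add_sub_cancel' hle]
    rw [h1, mul_assoc] at hi
    exact Nat.eq_of_mul_eq_mul_left (pow_pos hL _) hi
  have hint : a i = ((L ^ (lv' - lv) : ℕ) : ℤ) * a' i := by
    have e1 : ((a i).toNat : ℤ) = a i := Int.toNat_of_nonneg (ha i).1
    have e2 : ((a' i).toNat : ℤ) = a' i := Int.toNat_of_nonneg (ha' i).1
    rw [← e1, ← e2, hnat]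
    push_cast
    ring
  show a i / ((L ^ (lv' - lv) : ℕ) : ℤ) = a' i
  rw [hint, Int.mul_ediv_cancel_left _ hL'.ne']

/-! ## §4 Anchors along the flow: the re-blocked root anchor and the current domain -/

/-- **THE RE-BLOCKED ROOT ANCHOR AT STEP `t`**: the step-`t` cube containing the anchor cube of the first-born
constituent (formed at `P.rootStep`). [folklore] -/
def anchorAt (L : ℕ) (s : ℕ → ℕ) (P : PGen (Pt d × Finset (Pt d))) (t : ℕ) : Pt d :=
  coarse (Qfrom L s P.rootStep (t - P.rootStep)) (rootAnchor P)

/-- **THE CURRENT DOMAIN AT THE CUTOFF `K`** of a component with history `P` and last-event domain `Z`: the orbit of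
`Z` from `P.lastStep`, `K − P.lastStep` steps on. [folklore] -/
def curDomain (L : ℕ) (s : ℕ → ℕ) (P : PGen (Pt d × Finset (Pt d))) (Z : Finset (Pt d)) (K : ℕ) : Finset (Pt d) :=
  orbit L s P.lastStep Z (K - P.lastStep)

/-- `Qfrom` composition in the subtractive form used along histories: `j ≤ t ≤ u` [folklore] -/
theorem Qfrom_sub_split (L : ℕ) (s : ℕ → ℕ) {j t u : ℕ} (hjt : j ≤ t) (htu : t ≤ u) :
    Qfrom L s j (u - j) = Qfrom L s j (t - j) * Qfrom L s t (u - t) := by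
  rw [show u - j = (t - j) + (u - t) by omega, Qfrom_add, show j + (t - j) = t by omega]

/-- re-blocking the anchor in two stages is re-blocking it in one [folklore] -/
theorem coarse_anchorAt (L : ℕ) (s : ℕ → ℕ) (P : PGen (Pt d × Finset (Pt d))) {t u : ℕ} (hjt : P.rootStep ≤ t)
    (htu : t ≤ u) : coarse (Qfrom L s t (u - t)) (anchorAt L s P t) = anchorAt L s P u := by
  unfold anchorAt
  rw [coarse_coarse, ← Qfrom_sub_split L s hjt htu]

/-- **THE CURRENT DOMAIN CONTAINS THE RE-BLOCKED ROOT ANCHOR**: if the last-event domain TRACKS the anchor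
(`anchorAt L s P P.lastStep ∈ Z`: «a first large field region contained in Z») and `rootStep ≤ lastStep ≤ K`, then
`anchorAt L s P K ∈ curDomain L s P Z K` (S-expansiveness). [folklore] -/
theorem anchorAt_mem_curDomain (L : ℕ) (s : ℕ → ℕ) {P : PGen (Pt d × Finset (Pt d))} {Z : Finset (Pt d)} {K : ℕ}
    (htr : anchorAt L s P P.lastStep ∈ Z) (hj : P.rootStep ≤ P.lastStep) (hK : P.lastStep ≤ K) :
    anchorAt L s P K ∈ curDomain L s P Z K := by
  rw [← coarse_anchorAt L s P hj hK]
  exact coarse_Qfrom_mem_orbit L s P.lastStep htr _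

/-! ## §5 The displayed reading, Skolemised, and the discharge of the two cell fields -/

section Reading

variable {ι α π : Type*} [DecidableEq α]

/-- **THE PER-TERM READING AS REALISED PENDING PEDIGREES WITH THEIR DOMAINS** (the displayed H3 reading map in
geometric form, Skolemised — typer T-NE7b-6′).  For every cutoff `K ≥ K₀` and term `τ ∈ T K`: the encoding facts
`renew_step`∕`forest`∕`headOldest` of `HistoryAssemblyRealiseLE.RealisedReading`; for every live component `c`, with
`P := (ped K τ).toPGen (cellP K τ) c` its region history and `Z K τ c` its last-event domain: `real` — `P` is REALISED
by `Z K τ c` and PENDING at `K`; `track` — `Z K τ c` contains the re-blocked anchor cube of the first-born constituent;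
`disjoint` — distinct live components have disjoint current domains at `K`; `inBox` — the root anchor lies in the
period box of the `n·L^K` torus at the model scale `levelOf s K P.rootStep` of its birth step. [folklore] -/
structure RealisedDomains (L : ℕ) (s : ℕ → ℕ) (n K₀ : ℕ) (R : ℕ → ℕ → ℕ) (T : ℕ → Finset ι)
    (ped : ℕ → ι → Pedigree α π) (cellP : ℕ → ι → π → Pt d × Finset (Pt d)) (liveC : ℕ → ι → Finset α)
    (Z : ℕ → ι → α → Finset (Pt d)) : Prop where
  /-- encoding: a renewal is dated one step after the renewed part -/
  renew_step : ∀ K, K₀ ≤ K → ∀ τ ∈ T K, ∀ c c', Part.old c' true ∈ (ped K τ).parts c →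
    (ped K τ).step c' + 1 = (ped K τ).step c
  /-- the pedigree is a forest -/
  forest : ∀ K, K₀ ≤ K → ∀ τ ∈ T K, ∀ c, (ped K τ).Forest c
  /-- oldest line first at every component -/
  headOldest : ∀ K, K₀ ≤ K → ∀ τ ∈ T K, ∀ c, (ped K τ).HeadOldest c
  /-- every live component is realised by its domain and pending at the cutoff -/
  real : ∀ K, K₀ ≤ K → ∀ τ ∈ T K, ∀ c ∈ liveC K τ,
    Realises L s (R K) ((ped K τ).toPGen (cellP K τ) c) (Z K τ c) ∧
      PendingAt L s (R K) ((ped K τ).toPGen (cellP K τ) c).lastStep (Z K τ c) K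
  /-- the domain contains the re-blocked anchor cube of the first-born constituent -/
  track : ∀ K, K₀ ≤ K → ∀ τ ∈ T K, ∀ c ∈ liveC K τ,
    anchorAt L s ((ped K τ).toPGen (cellP K τ) c) ((ped K τ).toPGen (cellP K τ) c).lastStep ∈ Z K τ c
  /-- distinct live components of one term have disjoint current domains at the cutoff -/
  disjoint : ∀ K, K₀ ≤ K → ∀ τ ∈ T K, ∀ c ∈ liveC K τ, ∀ c' ∈ liveC K τ, c ≠ c' →
    Disjoint (curDomain L s ((ped K τ).toPGen (cellP K τ) c) (Z K τ c) K)
      (curDomain L s ((ped K τ).toPGen (cellP K τ) c') (Z K τ c') K)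
  /-- root anchors lie in the period box at the model scale of their birth step -/
  inBox : ∀ K, K₀ ≤ K → ∀ τ ∈ T K, ∀ c ∈ liveC K τ, ∀ i,
    0 ≤ rootAnchor ((ped K τ).toPGen (cellP K τ) c) i ∧
      L ^ levelOf s K ((ped K τ).toPGen (cellP K τ) c).rootStep *
        (rootAnchor ((ped K τ).toPGen (cellP K τ) c) i).toNat < n * L ^ K

/-- **THE ROOT CELL, DEFINED**: the corner cell of the root anchor at the model scale of the root step. [folklore] -/
def cellOfA (n L : ℕ) (s : ℕ → ℕ) (ped : ℕ → ι → Pedigree α π) (cellP : ℕ → ι → π → Pt d × Finset (Pt d)) :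
    ℕ → ι → α → (Fin d → ℕ) := fun K τ c =>
  cornerCell n L K (levelOf s K ((ped K τ).toPGen (cellP K τ) c).rootStep)
    (rootAnchor ((ped K τ).toPGen (cellP K τ) c))

variable {L : ℕ} {s : ℕ → ℕ} {n K₀ : ℕ} {R : ℕ → ℕ → ℕ} {T : ℕ → Finset ι} {ped : ℕ → ι → Pedigree α π}
  {cellP : ℕ → ι → π → Pt d × Finset (Pt d)} {liveC : ℕ → ι → Finset α} {Z : ℕ → ι → α → Finset (Pt d)}

/-- a realised pending history has `rootStep ≤ lastStep ≤ K` [folklore] -/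
theorem rootStep_le_of_real {P : PGen (Pt d × Finset (Pt d))} {ZP : Finset (Pt d)} {K : ℕ}
    (h : Realises L s (R K) P ZP ∧ PendingAt L s (R K) P.lastStep ZP K) :
    P.rootStep ≤ P.lastStep ∧ P.lastStep ≤ K :=
  ⟨(adm_of_realises P ZP h.1 h.2.1).rootStep_le_lastStep, h.2.1⟩

/-- **THE TWO CELL FIELDS DISCHARGED**: the displayed reading with domains gives leaf-03's `RealisedReading` for the
DEFINED root-cell map `cellOfA` — `cell_mem` by `cornerCell_mem_cellN` (`rootStep ≤ levelOf ≤ K`), `cell_inj` on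
absolute corners by `coarse_eq_of_cornerCell_eq` + `Qfrom_eq_pow_levelOf_sub` + `anchorAt_mem_curDomain` (`track`) +
`disjoint` — for `L, n ≥ 1` and stepwise non-increasing, drop-controlled exponents. [folklore] -/
theorem realisedReading_of_domains (hL : 0 < L) (hn : 0 < n) (hs : ∀ t, s (t + 1) ≤ s t)
    (hdrop : ∀ m, DropCtl s m) (H : RealisedDomains L s n K₀ R T ped cellP liveC Z) :
    RealisedReading L s (cellN d n L) K₀ R T ped cellP liveC (cellOfA n L s ped cellP) where
  renew_step := H.renew_step
  forest := H.forest
  headOldest := H.headOldest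
  real K hK τ hτ c hc := ⟨Z K τ c, H.real K hK τ hτ c hc⟩
  cell_mem K hK τ hτ c hc := by
    have hsK : ∀ t, t < K → s (t + 1) ≤ s t := fun t _ => hs t
    obtain ⟨hjt, htK⟩ := rootStep_le_of_real (H.real K hK τ hτ c hc)
    have hjK := hjt.trans htK
    rw [← Pedigree.rootStep_toPGen (ped K τ) (cellP K τ) (H.renew_step K hK τ hτ) c]
    exact cornerCell_mem_cellN (mul_pos hn (pow_pos hL K)) (le_levelOf hsK _)
      ((levelFn_levelOf hsK (hdrop K)).le_K _ hjK) _
  cell_inj K hK τ hτ := by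
    have hsK : ∀ t, t < K → s (t + 1) ≤ s t := fun t _ => hs t
    have hLF := levelFn_levelOf hsK (hdrop K)
    -- the symmetric core: an OLDER-rooted `c` and a younger-rooted `c'` with equal corner cells coincide
    have key : ∀ c ∈ liveC K τ, ∀ c' ∈ liveC K τ,
        ((ped K τ).toPGen (cellP K τ) c).rootStep ≤ ((ped K τ).toPGen (cellP K τ) c').rootStep →
        cellOfA n L s ped cellP K τ c = cellOfA n L s ped cellP K τ c' → c = c' := by
      intro c hc c' hc' hjj heq
      by_contra hne
      set P := (ped K τ).toPGen (cellP K τ) c with hP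
      set P' := (ped K τ).toPGen (cellP K τ) c' with hP'
      obtain ⟨hjt, htK⟩ := rootStep_le_of_real (H.real K hK τ hτ c hc)
      obtain ⟨hjt', htK'⟩ := rootStep_le_of_real (H.real K hK τ hτ c' hc')
      have hj'K : P'.rootStep ≤ K := hjt'.trans htK'
      -- equal corners ⇒ nested anchor cubes
      have hnest : coarse (L ^ (levelOf s K P'.rootStep - levelOf s K P.rootStep)) (rootAnchor P) = rootAnchor P' :=
        coarse_eq_of_cornerCell_eq hL (H.inBox K hK τ hτ c hc) (H.inBox K hK τ hτ c' hc') (hLF.monotone hjj) heq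
      rw [← Qfrom_eq_pow_levelOf_sub hL hs hdrop hjj hj'K] at hnest
      -- so the re-blocked older anchor at `K` is the re-blocked younger anchor at `K`
      have hAA : anchorAt L s P K = anchorAt L s P' K := by
        rw [← coarse_anchorAt L s P hjj hj'K]
        unfold anchorAt
        rw [hnest]
      -- both current domains contain it
      have hm : anchorAt L s P K ∈ curDomain L s P (Z K τ c) K :=
        anchorAt_mem_curDomain L s (H.track K hK τ hτ c hc) hjt htK
      have hm' : anchorAt L s P' K ∈ curDomain L s P' (Z K τ c') K :=
        anchorAt_mem_curDomain L s (H.track K hK τ hτ c' hc') hjt' htK'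
      rw [hAA] at hm
      exact Finset.disjoint_left.1 (H.disjoint K hK τ hτ c hc c' hc' hne) hm hm'
    intro c hc c' hc' heq
    rcases le_total ((ped K τ).toPGen (cellP K τ) c).rootStep ((ped K τ).toPGen (cellP K τ) c').rootStep with h | h
    · exact key c (Finset.mem_coe.1 hc) c' (Finset.mem_coe.1 hc') h heq
    · exact (key c' (Finset.mem_coe.1 hc') c (Finset.mem_coe.1 hc) h heq.symm).symm

end Reading

end

end Summit.QuantumFields.BalabanUV.T4Continuum.HistoryRealiseCells
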